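import Literature.MathematicalPhysics.QuantumFieldTheory.Balaban1983to89.Node00.Record13NumericsOfThm1

/-!
# NODE 00 (YM-PLAN Track A) — STAGE 13: THE NUMERICS KEYED TO [15]'s CONSTANTS `(B₃, a₀, a₁)` AND TO THE BLOCK SIZE `L` meeting ALSO the letters of the
# GAUGE HALF of row P11 (node00-def-P11 FILE 4∕5: `O(1)LMB > 2(d−1)LM`, `BCM > 2(d−1)M`, chart reachability through the class bounds) — the second one-def re-pin,
# and the `L`-keyed witness `θ₁₅ᶜ = theta13OfThm1C` with its faces

Cell `pub-ymgap`, seat `pub-ymgap-node00-def-K0a` (g4), FILE 11a (companion FILE 11b `Node00/Record13InhabitedOfThm1C` lifts node00-def-P11's FILE 5 v1.1 supplier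
`bgProvisoΛ_UbgMSOfRecord_of_thm1Scaled_compatible'` to the Stage-13 parameter and composes it with the K0a socket at `θ₁₅ᶜ`).  FILE 10a
(`Node00/Record13NumericsOfThm1`) met node00-def-P11 FILE 2's letters (`0 < cR·ε_m ≤ a₁`, `B₃·cR·ε_m ≤ εreg ≤ a₀`, `B₃·cR·A₀ ≤ (1 − β)·C₀`); the gauge half of the row
(FILE 4 `Node00/Record12BgRowGaugeAxial`, FILE 5 `Node00/Record12BgRowCubeGeometry` v1.1; node00-def-P11 NUMERICS NOTE, pub-ymgap INBOX) adds: `cB > 2(d−1)·L·M` ([I]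
(1.12)'s `O(1)LMB`, «B sufficiently large»), `B·C·Mr > 2(d−1)·M` ([III] (2.38)'s `BCM`), and the chart-reachability bounds `(d−1)·L·M·η_j·(B₃·cR·ε_j) ≤ ½`,
`(d−1)·M·η_n·(B₃·cR·ε_n) ≤ ½` — met here by ONE more numerics definition (the §2 letter `cB` becomes `L`-KEYED, as the far-field letter of FILE 7 is: LOCATED-L).
[I] = [Balaban1987RG1], [III] = [Balaban1988Convergent], [IV] = [Balaban1989LargeFieldI], [15] = [Balaban1985Variational].

WHAT THIS FILE PROVIDES.
* §1 THE LETTERS: `A0OfThm1C B₃ a₀ a₁ := A0OfThm1 B₃ a₀ a₁ ∕ 8` (`0 < A₀ᶜ ≤ A₀`, so `A₀ᶜ ≤ a₁`, `B₃·A₀ᶜ ≤ a₀`, and `B₃·A₀ᶜ ≤ 1∕16`); `numerics7OfThm1C ε₀ B₃ a₀ a₁`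
  (the family's Stage-7 numerics with `A₀ := A0OfThm1C`, `εreg := a₀`); `sect2NumericsOfThm1C L := { sect2NumericsOfFamily with cB := 6·L + 1, B := 7 }` (so
  `cB > 6L = 2(d−1)·L·M` and `B·C·Mr = 7 > 6 = 2(d−1)·M` at `d = 4`, `M = C = Mr = 1`; `β = ¼`, `cR = 1`, `lf = lfConstsOfFamily` — `κ = 2·10⁴`, `C₀ = 1`, `q₀ = 2` —
  UNCHANGED, `rfl`); `stage12NumericsOfThm1C L ε₀ B₃ a₀ a₁` + `rfl` views + `stage12NumericsOfThm1C_pos (hε) (hB) (ha₀) (ha₁)`.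
* §2 WINDOW ⇒ LETTERS IN KERNEL at the new numerics: `numerics_thm1C_of_inInterval` (def-P11's (hnum)), `mul_A0_nonneg_thm1C` ∕ `mul_A0_le_C₀_thm1C` ((hBα)'s inputs),
  `mul_epsOfRecord_thm1C_le` (`B₃·cR·ε_m ≤ 1∕16` along any history in a window `]0, γ]`), `one_lt_log_inv_sq_of_le_half` (`g ≤ ½ ⇒ 1 < log g⁻²`, the input of def-P11's (C1)
  `exists_RkOfRecord_eq_mul`), `cast_mul_eta_le_one` (`L·η_j ≤ 1`, `j ≥ 1`; `η_n ≤ 1` is BIJ85's `eta_le_one`, inlined where used).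
* §3 THE `L`-KEYED WITNESS `theta13OfThm1C F N ε₀ ε₂₉ B₃ a₀ a₁ := theta13LiveOfNumerics F N (stage12NumericsOfThm1C F.L ε₀ B₃ a₀ a₁) ε₂₉ (ζ, Rz, Zt of record)` (a MEMBER of
  FILE 9's all-numerics family, `rfl`), `rfl` views (`_cB = 6·F.L + 1`, `_B = 7`, …) and faces (`admissible_` under the five signs, `eight_le_L_`, `kp_tree_∕kp_large_∕kp_n10_`,
  `hasResidualsOfRecord_`, `ztUnity_`, `slotsNondegenerate₁₃_ (h)`).

HONEST FRAMING.  Bookkeeping of a re-pinned parameter family + elementary real inequalities; the numerals are displayed choices meeting node00-def-P11's letter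
inequalities for ANY values of print's undetermined constants `B₃ ≥ 0`, `a₀, a₁ > 0` and any block size `L` — not Bałaban's constants; nothing of Bałaban asserted; NOT a
discharge; K0‴ NOT closed by this file; counts unmoved (typed 28∕28 · discharged 5∕28); one finite 𝕋⁴ programme at fixed ε — NOT continuum ∕ OS ∕ mass gap ∕ Clay.
No `sorry`, no `axiom`, no `instance`, no `notation`.
-/

noncomputable section

open MeasureTheory
open scoped Matrix.Norms.L2Operator

namespace Literature.MathematicalPhysics.QuantumFieldTheory.Balaban1983to89.Node00

open T4Continuum B14.Eq218Concrete B15DeterminingSets B12RegularSpaces111 B14RegularSpaces234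

/-! ## §1. The letters meeting both halves of row P11, and the numerics carrying them -/

section Letters

/-- **THE PROFILE CONSTANT FOR BOTH HALVES OF ROW P11**: `A₀ᶜ(B₃, a₀, a₁) := A₀(B₃, a₀, a₁) ∕ 8` — the extra factor makes the chart-reachability bounds of the gauge half
(`(d−1)·L·M·η_j·(B₃·cR·ε_j) ≤ ½`) hold with `B₃·A₀ᶜ ≤ 1∕16` (a displayed choice, not Bałaban's constant). [cite: Balaban1988Convergent, (2.4) p.255, (2.28) p.259, p.256; Balaban1985Variational, Thm 1 (7)–(10) p.279 (bookkeeping witness)] -/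
def A0OfThm1C (B₃ a₀ a₁ : ℝ) : ℝ :=
  A0OfThm1 B₃ a₀ a₁ / 8

variable {B₃ a₀ a₁ : ℝ}

/-- `0 < A₀ᶜ` under print's signs. [cite: Balaban1988Convergent, (2.4) p.255 (bookkeeping)] -/
theorem A0OfThm1C_pos (hB : 0 ≤ B₃) (ha₀ : 0 < a₀) (ha₁ : 0 < a₁) : 0 < A0OfThm1C B₃ a₀ a₁ :=
  div_pos (A0OfThm1_pos hB ha₀ ha₁) (by norm_num)

/-- `0 ≤ A₀ᶜ` under the weak signs. [cite: Balaban1988Convergent, (2.4) p.255 (bookkeeping)] -/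
theorem A0OfThm1C_nonneg (hB : 0 ≤ B₃) (ha₀ : 0 ≤ a₀) (ha₁ : 0 ≤ a₁) : 0 ≤ A0OfThm1C B₃ a₀ a₁ :=
  div_nonneg (A0OfThm1_nonneg hB ha₀ ha₁) (by norm_num)

/-- `A₀ᶜ ≤ A₀`. [cite: Balaban1988Convergent, (2.4) p.255 (bookkeeping)] -/
theorem A0OfThm1C_le (hB : 0 ≤ B₃) (ha₀ : 0 ≤ a₀) (ha₁ : 0 ≤ a₁) : A0OfThm1C B₃ a₀ a₁ ≤ A0OfThm1 B₃ a₀ a₁ :=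
  div_le_self (A0OfThm1_nonneg hB ha₀ ha₁) (by norm_num)

/-- `A₀ᶜ ≤ a₁`. [cite: Balaban1985Variational, Thm 1 (7) p.279 (bookkeeping)] -/
theorem A0OfThm1C_le_a₁ (hB : 0 ≤ B₃) (ha₀ : 0 ≤ a₀) (ha₁ : 0 ≤ a₁) : A0OfThm1C B₃ a₀ a₁ ≤ a₁ :=
  (A0OfThm1C_le hB ha₀ ha₁).trans (A0OfThm1_le_a₁ hB ha₀ ha₁)

/-- `B₃·A₀ᶜ ≤ a₀`. [cite: Balaban1985Variational, Thm 1 (8) p.279 (bookkeeping)] -/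
theorem mul_A0OfThm1C_le_a₀ (hB : 0 ≤ B₃) (ha₀ : 0 ≤ a₀) (ha₁ : 0 ≤ a₁) : B₃ * A0OfThm1C B₃ a₀ a₁ ≤ a₀ :=
  (mul_le_mul_of_nonneg_left (A0OfThm1C_le hB ha₀ ha₁) hB).trans (mul_A0OfThm1_le_a₀ hB ha₀)

/-- `B₃·A₀ᶜ ≤ 1∕16`. [cite: Balaban1988Convergent, (2.28) p.259, p.256 (bookkeeping)] -/
theorem mul_A0OfThm1C_le (hB : 0 ≤ B₃) : B₃ * A0OfThm1C B₃ a₀ a₁ ≤ 1 / 16 := by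
  unfold A0OfThm1C
  have h := mul_A0OfThm1_le_half (a₀ := a₀) (a₁ := a₁) hB
  rw [mul_div_assoc']
  linarith

/-- **def-R's Stage-7 numerics FOR BOTH HALVES OF ROW P11**: the family's with `A₀ := A0OfThm1C B₃ a₀ a₁`, `εreg := a₀`. [cite: Balaban1988Convergent, (2.4) p.255, (2.12) p.256; Balaban1985Variational, Thm 1 p.279 (bookkeeping witness)] -/
def numerics7OfThm1C (ε₀ B₃ a₀ a₁ : ℝ) : Stage7Numerics :=
  { numerics7OfFamily ε₀ with A₀ := A0OfThm1C B₃ a₀ a₁, εreg := a₀ }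

/-- Its (1.2) letter IS the argument (`rfl`). [cite: Balaban1987RG1, (1.2) p.260 (bookkeeping)] -/
theorem numerics7OfThm1C_ε₀ (ε₀ B₃ a₀ a₁ : ℝ) : (numerics7OfThm1C ε₀ B₃ a₀ a₁).ε₀ = ε₀ := rfl

/-- Its profile constant IS `A₀ᶜ` (`rfl`). [cite: Balaban1988Convergent, (2.4) p.255 (bookkeeping)] -/
theorem numerics7OfThm1C_A₀ (ε₀ B₃ a₀ a₁ : ℝ) : (numerics7OfThm1C ε₀ B₃ a₀ a₁).A₀ = A0OfThm1C B₃ a₀ a₁ := rfl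

/-- Its regularity threshold IS `a₀` (`rfl`). [cite: Balaban1985Variational, Thm 1 p.279 (bookkeeping)] -/
theorem numerics7OfThm1C_εreg (ε₀ B₃ a₀ a₁ : ℝ) : (numerics7OfThm1C ε₀ B₃ a₀ a₁).εreg = a₀ := rfl

/-- Its profile exponent is the family's `p₀ = 1` (`rfl`). [cite: Balaban1988Convergent, (2.4) p.255 (bookkeeping)] -/
theorem numerics7OfThm1C_p₀ (ε₀ B₃ a₀ a₁ : ℝ) : (numerics7OfThm1C ε₀ B₃ a₀ a₁).p₀ = 1 := rfl

/-- Its (2.5) exponent is the family's `r = 1` (`rfl`). [cite: Balaban1988Convergent, (2.5) p.255 (bookkeeping)] -/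
theorem numerics7OfThm1C_r (ε₀ B₃ a₀ a₁ : ℝ) : (numerics7OfThm1C ε₀ B₃ a₀ a₁).r = 1 := rfl

/-- **THE §2 NUMERICS KEYED TO THE BLOCK SIZE `L`**: the family's with `O(1)LMB := 6·L + 1` ([I] (1.12); «B sufficiently large»: `> 2(d−1)·L·M` at `d = 4`, `M = 1`) and
`B := 7` ([III] (2.38): `B·C·M = 7 > 2(d−1)·M = 6`). [cite: Balaban1987RG1, (1.12) p.262; Balaban1988Convergent, (2.38) p.261, p.256 (bookkeeping witness)] -/
def sect2NumericsOfThm1C (L : ℕ) : Sect2Numerics :=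
  { sect2NumericsOfFamily with cB := 6 * L + 1, B := 7 }

/-- Its term constants ARE the family's (`rfl`). [cite: Balaban1988Convergent, (2.28) p.259 (bookkeeping)] -/
theorem sect2NumericsOfThm1C_lf (L : ℕ) : (sect2NumericsOfThm1C L).lf = lfConstsOfFamily := rfl

/-- Its (1.12) constant IS `6·L + 1` (`rfl`). [cite: Balaban1987RG1, (1.12) p.262 (bookkeeping)] -/
theorem sect2NumericsOfThm1C_cB (L : ℕ) : (sect2NumericsOfThm1C L).cB = 6 * L + 1 := rfl

/-- Its (2.38) constant `B` IS `7` (`rfl`). [cite: Balaban1988Convergent, (2.38) p.261 (bookkeeping)] -/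
theorem sect2NumericsOfThm1C_B (L : ℕ) : (sect2NumericsOfThm1C L).B = 7 := rfl

/-- The `L`-keyed §2 numerics meet the §2 signs (`0 < 6L + 1`, `0 ≤ ¼ < 1`, `0 < 7·1·1`). [cite: Balaban1988Convergent, (2.34)–(2.39) p.261 (bookkeeping)] -/
theorem sect2NumericsOfThm1C_pos (L : ℕ) : (sect2NumericsOfThm1C L).Pos := by
  refine ⟨?_, ?_, ?_, ?_⟩
  · show (0 : ℝ) < 6 * (L : ℝ) + 1
    positivity
  all_goals norm_num [sect2NumericsOfThm1C, sect2NumericsOfFamily, sect2NumericsOfRecord₁₂]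

/-- **THE STAGE-12 NUMERICS FOR BOTH HALVES OF ROW P11**: the family's over `numerics7OfThm1C ε₀ B₃ a₀ a₁` and `sect2NumericsOfThm1C L`.
[cite: Balaban1988Convergent, (2.4) p.255, (2.10) p.256, (2.28) p.259, (2.38) p.261; Balaban1987RG1, (0.21) p.256, (1.12) p.262 (bookkeeping witness)] -/
def stage12NumericsOfThm1C (L : ℕ) (ε₀ B₃ a₀ a₁ : ℝ) : Stage12Numerics :=
  { stage12NumericsOfFamily ε₀ with ν := numerics7OfThm1C ε₀ B₃ a₀ a₁, s2 := sect2NumericsOfThm1C L }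

variable (L : ℕ) (ε₀ : ℝ)
variable (B₃ a₀ a₁)

/-- Its Stage-7 part (`rfl`). [cite: Balaban1988Convergent, (2.4) p.255 (bookkeeping)] -/
theorem stage12NumericsOfThm1C_ν : (stage12NumericsOfThm1C L ε₀ B₃ a₀ a₁).ν = numerics7OfThm1C ε₀ B₃ a₀ a₁ := rfl

/-- Its §2 numerics (`rfl`). [cite: Balaban1988Convergent, (2.28) p.259 (bookkeeping)] -/
theorem stage12NumericsOfThm1C_s2 : (stage12NumericsOfThm1C L ε₀ B₃ a₀ a₁).s2 = sect2NumericsOfThm1C L := rfl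

/-- Its window constant is the family's `γ = ½` (`rfl`). [cite: Balaban1987RG1, Thm 1 p.255 (bookkeeping)] -/
theorem stage12NumericsOfThm1C_γ : (stage12NumericsOfThm1C L ε₀ B₃ a₀ a₁).γ = 1 / 2 := rfl

/-- Its located regularity constant is the family's `cR = 1` (`rfl`). [cite: Balaban1988Convergent, (2.10) p.256 (bookkeeping)] -/
theorem stage12NumericsOfThm1C_cR : (stage12NumericsOfThm1C L ε₀ B₃ a₀ a₁).s2.cR = 1 := rfl

/-- Its (2.34) constant is the family's `β = ¼` (`rfl`). [cite: Balaban1988Convergent, (2.34) p.261 (bookkeeping)] -/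
theorem stage12NumericsOfThm1C_βc : (stage12NumericsOfThm1C L ε₀ B₃ a₀ a₁).s2.βc = 1 / 4 := rfl

/-- Its term constants ARE the family's (`rfl`). [cite: Balaban1988Convergent, (2.28) p.259 (bookkeeping)] -/
theorem stage12NumericsOfThm1C_lf : (stage12NumericsOfThm1C L ε₀ B₃ a₀ a₁).s2.lf = lfConstsOfFamily := rfl

/-- Its tower numerics ARE the record's (`rfl`). [cite: Balaban1989LargeFieldI, (2.1) p.182 (bookkeeping)] -/
theorem stage12NumericsOfThm1C_τ9 : (stage12NumericsOfThm1C L ε₀ B₃ a₀ a₁).τ9 = towerNumericsOfRecord₁₂ := rfl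

/-- Its (1.16) constant is the family's `A₁ = 1` (`rfl`). [cite: Balaban1987RG1, (1.16) p.262 (bookkeeping)] -/
theorem stage12NumericsOfThm1C_A₁ : (stage12NumericsOfThm1C L ε₀ B₃ a₀ a₁).A₁ = 1 := rfl

variable {L ε₀ B₃ a₀ a₁}

/-- **THE NUMERICS MEET EVERY SIGN WINDOW** (`Stage12Numerics.Pos`) under `0 < ε₀`, `0 ≤ B₃`, `0 < a₀`, `0 < a₁`. [cite: Balaban1988Convergent, (2.4) p.255, (2.10) p.256, (2.28) p.259, (2.34)–(2.39) p.261; Balaban1987RG1, (0.21) p.256; Balaban1985Variational, Thm 1 p.279 (bookkeeping)] -/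
theorem stage12NumericsOfThm1C_pos (hε : 0 < ε₀) (hB : 0 ≤ B₃) (ha₀ : 0 < a₀) (ha₁ : 0 < a₁) : (stage12NumericsOfThm1C L ε₀ B₃ a₀ a₁).Pos := by
  refine ⟨⟨hε, ha₀, A0OfThm1C_pos hB ha₀ ha₁, ?_, ?_⟩, ?_, ⟨?_, ?_⟩, ?_, ?_, sect2NumericsOfThm1C_pos L, ?_, ?_, ?_⟩ <;>
    norm_num [stage12NumericsOfThm1C, numerics7OfThm1C, sect2NumericsOfThm1C, stage12NumericsOfFamily, stage12NumericsOfRecord, numerics7OfFamily,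
      numerics7OfRecord₁₂, towerNumericsOfRecord₁₂, sect2NumericsOfFamily, sect2NumericsOfRecord₁₂, lfConstsOfFamily, lfConstsOfRecord₁₂]

end Letters

/-! ## §2. Window ⇒ the letter inequalities of BOTH halves, in kernel -/

section Window

variable {L : ℕ} {ε₀ B₃ a₀ a₁ : ℝ}

/-- **def-P11's (hnum) AT THE NEW NUMERICS, along every history in a window `]0, γ]`, `γ < 1`**: `0 < cR·ε_m`, `cR·ε_m ≤ a₁`, `B₃·cR·ε_m ≤ εreg` for `m ≤ n`.
[cite: Balaban1988Convergent, (2.4) p.255, (2.10) p.256, (2.12) p.256; Balaban1985Variational, Thm 1 (7)–(8) p.279] -/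
theorem numerics_thm1C_of_inInterval (hB : 0 ≤ B₃) (ha₀ : 0 < a₀) (ha₁ : 0 < a₁) {γ : ℝ} (hγ : γ < 1) {g : ℕ → ℝ} {n : ℕ}
    (hw : Step.InInterval γ n g) : ∀ m, m ≤ n →
      0 < (stage12NumericsOfThm1C L ε₀ B₃ a₀ a₁).s2.cR * epsOfRecord (stage12NumericsOfThm1C L ε₀ B₃ a₀ a₁).ν g m ∧
      (stage12NumericsOfThm1C L ε₀ B₃ a₀ a₁).s2.cR * epsOfRecord (stage12NumericsOfThm1C L ε₀ B₃ a₀ a₁).ν g m ≤ a₁ ∧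
      B₃ * ((stage12NumericsOfThm1C L ε₀ B₃ a₀ a₁).s2.cR * epsOfRecord (stage12NumericsOfThm1C L ε₀ B₃ a₀ a₁).ν g m) ≤
        (stage12NumericsOfThm1C L ε₀ B₃ a₀ a₁).ν.εreg := by
  intro m hm
  rw [stage12NumericsOfThm1C_cR, one_mul, stage12NumericsOfThm1C_ν, numerics7OfThm1C_εreg]
  have hA : 0 < (numerics7OfThm1C ε₀ B₃ a₀ a₁).A₀ := A0OfThm1C_pos hB ha₀ ha₁
  have hle : epsOfRecord (numerics7OfThm1C ε₀ B₃ a₀ a₁) g m ≤ A0OfThm1C B₃ a₀ a₁ :=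
    epsOfRecord_le_A₀_of_p₀_eq_one _ rfl hA.le (hw m hm).1
  exact ⟨epsOfRecord_pos _ hA (hw m hm).1 ((hw m hm).2.trans_lt hγ), hle.trans (A0OfThm1C_le_a₁ hB ha₀.le ha₁.le),
    (mul_le_mul_of_nonneg_left hle hB).trans (mul_A0OfThm1C_le_a₀ hB ha₀.le ha₁.le)⟩

/-- **THE CLASS BOUND IS AT MOST `1∕16`** along every history in a window `]0, γ]`: `B₃·(cR·ε_m) ≤ B₃·A₀ᶜ ≤ 1∕16`.
[cite: Balaban1988Convergent, (2.4) p.255, p.256 (bookkeeping)] -/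
theorem mul_epsOfRecord_thm1C_le (hB : 0 ≤ B₃) (ha₀ : 0 < a₀) (ha₁ : 0 < a₁) {γ : ℝ} {g : ℕ → ℝ} {n : ℕ}
    (hw : Step.InInterval γ n g) {m : ℕ} (hm : m ≤ n) :
    B₃ * ((stage12NumericsOfThm1C L ε₀ B₃ a₀ a₁).s2.cR * epsOfRecord (stage12NumericsOfThm1C L ε₀ B₃ a₀ a₁).ν g m) ≤ 1 / 16 := by
  rw [stage12NumericsOfThm1C_cR, one_mul, stage12NumericsOfThm1C_ν]
  have hA : 0 < (numerics7OfThm1C ε₀ B₃ a₀ a₁).A₀ := A0OfThm1C_pos hB ha₀ ha₁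
  have hle : epsOfRecord (numerics7OfThm1C ε₀ B₃ a₀ a₁) g m ≤ A0OfThm1C B₃ a₀ a₁ :=
    epsOfRecord_le_A₀_of_p₀_eq_one _ rfl hA.le (hw m hm).1
  exact (mul_le_mul_of_nonneg_left hle hB).trans (mul_A0OfThm1C_le hB)

/-- The «C₀ sufficiently large» inequality at the new numerics: `B₃·cR·A₀ᶜ ≤ (1 − β)·C₀` (`≤ 1∕16 ≤ ¾`). [cite: Balaban1988Convergent, (2.28) p.259, (2.34) p.261] -/
theorem mul_A0_le_C₀_thm1C (hB : 0 ≤ B₃) :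
    B₃ * (stage12NumericsOfThm1C L ε₀ B₃ a₀ a₁).s2.cR * (stage12NumericsOfThm1C L ε₀ B₃ a₀ a₁).ν.A₀ ≤
      (1 - (stage12NumericsOfThm1C L ε₀ B₃ a₀ a₁).s2.βc) * (stage12NumericsOfThm1C L ε₀ B₃ a₀ a₁).s2.lf.C₀ := by
  rw [stage12NumericsOfThm1C_cR, mul_one, stage12NumericsOfThm1C_ν, numerics7OfThm1C_A₀, stage12NumericsOfThm1C_βc, stage12NumericsOfThm1C_lf]
  have h := mul_A0OfThm1C_le (a₀ := a₀) (a₁ := a₁) hB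
  norm_num [lfConstsOfFamily, lfConstsOfRecord₁₂]
  linarith

/-- … and its sign `0 ≤ B₃·cR·A₀ᶜ`. [cite: Balaban1988Convergent, (2.28) p.259 (bookkeeping)] -/
theorem mul_A0_nonneg_thm1C (hB : 0 ≤ B₃) (ha₀ : 0 ≤ a₀) (ha₁ : 0 ≤ a₁) :
    0 ≤ B₃ * (stage12NumericsOfThm1C L ε₀ B₃ a₀ a₁).s2.cR * (stage12NumericsOfThm1C L ε₀ B₃ a₀ a₁).ν.A₀ := by
  rw [stage12NumericsOfThm1C_cR, mul_one, stage12NumericsOfThm1C_ν, numerics7OfThm1C_A₀]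
  exact mul_nonneg hB (A0OfThm1C_nonneg hB ha₀ ha₁)

/-- In the window `]0, ½]`: `1 < log g⁻²` (`g⁻² ≥ 4 > e`) — the input of node00-def-P11's (C1) `exists_RkOfRecord_eq_mul` ((2.5)'s least exponent is positive).
[cite: Balaban1988Convergent, (2.5) p.255 (elementary)] -/
theorem one_lt_log_inv_sq_of_le_half {g : ℝ} (h0 : 0 < g) (h : g ≤ 1 / 2) : 1 < Real.log (g ^ 2)⁻¹ := by
  have hg2 : 0 < g ^ 2 := pow_pos h0 2
  rw [Real.lt_log_iff_exp_lt (inv_pos.mpr hg2)]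
  have hg4 : g ^ 2 ≤ 1 / 4 := by nlinarith
  have h4 : (4 : ℝ) ≤ (g ^ 2)⁻¹ := by
    rw [le_inv_comm₀ (by norm_num) hg2, inv_eq_one_div]
    exact hg4
  have h3 := Real.exp_one_lt_d9
  norm_num at h3
  linarith

/-- `L·η_j ≤ 1` for `j ≥ 1` on `Setup.Params` (`η_j = L^{−j}`, `L ≥ 1`). [cite: Balaban1987RG1, (1.1) p.260 (bookkeeping)] -/
theorem cast_mul_eta_le_one (P : Params) {j : ℕ} (hj : 1 ≤ j) : (P.L : ℝ) * P.eta j ≤ 1 := by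
  have hL : (1 : ℝ) ≤ P.L := by exact_mod_cast P.L_pos
  have hL0 : (0 : ℝ) < P.L := by linarith
  unfold Params.eta
  obtain ⟨i, rfl⟩ := Nat.exists_eq_add_of_le hj
  rw [pow_add, pow_one, ← mul_assoc, mul_inv_cancel₀ hL0.ne', one_mul]
  exact pow_le_one₀ (inv_nonneg.mpr hL0.le) (inv_le_one_of_one_le₀ hL)

end Window

/-! ## §3. ★★ THE `L`-KEYED WITNESS `θ₁₅ᶜ = theta13OfThm1C F N ε₀ ε₂₉ B₃ a₀ a₁` and its faces -/

section Witness

variable (F : T4Family) (N : ℕ) [NeZero N] (ε₀ ε₂₉ B₃ a₀ a₁ : ℝ)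

/-- **THE `L`-KEYED [15]-KEYED STAGE-13 WITNESS** `θ₁₅ᶜ(ε₀, ε₂₉; B₃, a₀, a₁)`: the all-numerics live witness family (FILE 9 §3) AT `stage12NumericsOfThm1C F.L ε₀ B₃ a₀ a₁`, with
K0b's residuals of record — the re-pin at which BOTH halves of node00-def-P11's letter inequalities are theorems. [cite: Balaban1989LargeFieldI, (0.3) p.176 and p.177; Balaban1988Convergent, (2.4) p.255, (2.10) p.256, (2.28) p.259, (2.38) p.261; Balaban1987RG1, (1.12) p.262; Balaban1985Variational, Thm 1 p.279 (bookkeeping witness)] -/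
def theta13OfThm1C : Stage13Params F N :=
  theta13LiveOfNumerics F N (stage12NumericsOfThm1C F.L ε₀ B₃ a₀ a₁) ε₂₉
    (zeta316OfRecord F N (stage12NumericsOfThm1C F.L ε₀ B₃ a₀ a₁).ν (stage12NumericsOfThm1C F.L ε₀ B₃ a₀ a₁).τ9.M (stage12NumericsOfThm1C F.L ε₀ B₃ a₀ a₁).A₁)
    (RzOfRecord F N) (ZtOfRecord F N)

/-- Unfolding: `θ₁₅ᶜ` IS the member of the all-numerics family (`rfl`). [cite: Balaban1989LargeFieldI, (0.3) p.176 (bookkeeping)] -/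
theorem theta13OfThm1C_eq :
    theta13OfThm1C F N ε₀ ε₂₉ B₃ a₀ a₁ =
      theta13LiveOfNumerics F N (stage12NumericsOfThm1C F.L ε₀ B₃ a₀ a₁) ε₂₉
        (zeta316OfRecord F N (stage12NumericsOfThm1C F.L ε₀ B₃ a₀ a₁).ν (stage12NumericsOfThm1C F.L ε₀ B₃ a₀ a₁).τ9.M
          (stage12NumericsOfThm1C F.L ε₀ B₃ a₀ a₁).A₁)
        (RzOfRecord F N) (ZtOfRecord F N) := rfl

/-- `θ₁₅ᶜ.ν = numerics7OfThm1C ε₀ B₃ a₀ a₁` (`rfl`). [cite: Balaban1988Convergent, (2.4) p.255 (bookkeeping)] -/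
theorem theta13OfThm1C_ν : (theta13OfThm1C F N ε₀ ε₂₉ B₃ a₀ a₁).ν = numerics7OfThm1C ε₀ B₃ a₀ a₁ := rfl

/-- `θ₁₅ᶜ.ν.εreg = a₀` (`rfl`). [cite: Balaban1985Variational, Thm 1 p.279 (bookkeeping)] -/
theorem theta13OfThm1C_εreg : (theta13OfThm1C F N ε₀ ε₂₉ B₃ a₀ a₁).ν.εreg = a₀ := rfl

/-- `θ₁₅ᶜ.ν.A₀ = A₀ᶜ(B₃, a₀, a₁)` (`rfl`). [cite: Balaban1988Convergent, (2.4) p.255 (bookkeeping)] -/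
theorem theta13OfThm1C_A₀ : (theta13OfThm1C F N ε₀ ε₂₉ B₃ a₀ a₁).ν.A₀ = A0OfThm1C B₃ a₀ a₁ := rfl

/-- `θ₁₅ᶜ.ν.p₀ = 1` (`rfl`). [cite: Balaban1988Convergent, (2.4) p.255 (bookkeeping)] -/
theorem theta13OfThm1C_p₀ : (theta13OfThm1C F N ε₀ ε₂₉ B₃ a₀ a₁).ν.p₀ = 1 := rfl

/-- `θ₁₅ᶜ.ν.r = 1` (`rfl`). [cite: Balaban1988Convergent, (2.5) p.255 (bookkeeping)] -/
theorem theta13OfThm1C_r : (theta13OfThm1C F N ε₀ ε₂₉ B₃ a₀ a₁).ν.r = 1 := rfl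

/-- `θ₁₅ᶜ.ν.ε₀ = ε₀` (`rfl`). [cite: Balaban1987RG1, (1.2) p.260 (bookkeeping)] -/
theorem theta13OfThm1C_ε₀ : (theta13OfThm1C F N ε₀ ε₂₉ B₃ a₀ a₁).ν.ε₀ = ε₀ := rfl

/-- `θ₁₅ᶜ.ε₂₉ = ε₂₉` (`rfl`). [cite: Balaban1987RG1, (2.9) p.266 (bookkeeping)] -/
theorem theta13OfThm1C_ε₂₉ : (theta13OfThm1C F N ε₀ ε₂₉ B₃ a₀ a₁).ε₂₉ = ε₂₉ := rfl

/-- `θ₁₅ᶜ.γ = ½` (`rfl`). [cite: Balaban1987RG1, Thm 1 p.255 (bookkeeping)] -/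
theorem theta13OfThm1C_γ : (theta13OfThm1C F N ε₀ ε₂₉ B₃ a₀ a₁).γ = 1 / 2 := rfl

/-- `θ₁₅ᶜ.s2 = sect2NumericsOfThm1C F.L` (`rfl`). [cite: Balaban1988Convergent, (2.28) p.259 (bookkeeping)] -/
theorem theta13OfThm1C_s2 : (theta13OfThm1C F N ε₀ ε₂₉ B₃ a₀ a₁).s2 = sect2NumericsOfThm1C F.L := rfl

/-- `θ₁₅ᶜ.s2.cB = 6·F.L + 1` (`rfl`) — the LOCATED-L letter of the gauge half. [cite: Balaban1987RG1, (1.12) p.262 (bookkeeping)] -/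
theorem theta13OfThm1C_cB : (theta13OfThm1C F N ε₀ ε₂₉ B₃ a₀ a₁).s2.cB = 6 * F.L + 1 := rfl

/-- `θ₁₅ᶜ.s2.B = 7` (`rfl`). [cite: Balaban1988Convergent, (2.38) p.261 (bookkeeping)] -/
theorem theta13OfThm1C_B : (theta13OfThm1C F N ε₀ ε₂₉ B₃ a₀ a₁).s2.B = 7 := rfl

/-- `θ₁₅ᶜ.s2.C = 1` (`rfl`). [cite: Balaban1988Convergent, (2.38) p.261 (bookkeeping)] -/
theorem theta13OfThm1C_C : (theta13OfThm1C F N ε₀ ε₂₉ B₃ a₀ a₁).s2.C = 1 := rfl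

/-- `θ₁₅ᶜ.s2.Mr = 1` (`rfl`). [cite: Balaban1988Convergent, (2.38) p.261 (bookkeeping)] -/
theorem theta13OfThm1C_Mr : (theta13OfThm1C F N ε₀ ε₂₉ B₃ a₀ a₁).s2.Mr = 1 := rfl

/-- `θ₁₅ᶜ.s2.cR = 1` (`rfl`). [cite: Balaban1988Convergent, (2.10) p.256 (bookkeeping)] -/
theorem theta13OfThm1C_cR : (theta13OfThm1C F N ε₀ ε₂₉ B₃ a₀ a₁).s2.cR = 1 := rfl

/-- `θ₁₅ᶜ.s2.lf.κ = 2·10⁴` (`rfl`). [cite: Balaban1987RG1, (1.18) p.263 (bookkeeping)] -/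
theorem theta13OfThm1C_κ : (theta13OfThm1C F N ε₀ ε₂₉ B₃ a₀ a₁).s2.lf.κ = 20000 := rfl

/-- The term constants of record at `θ₁₅ᶜ` ARE the family's with `γ = ½` (`rfl`). [cite: Balaban1988Convergent, (2.28) p.259 (bookkeeping)] -/
theorem lfOfRecord₁₂_theta13OfThm1C :
    lfOfRecord₁₂ F N (theta13OfThm1C F N ε₀ ε₂₉ B₃ a₀ a₁).toStage12Params = { lfConstsOfFamily with γ := 1 / 2 } := rfl

/-- `θ₁₅ᶜ.τ9.M = 1` (`rfl`). [cite: Balaban1989LargeFieldI, (2.1) p.182 (bookkeeping)] -/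
theorem theta13OfThm1C_τ9_M : (theta13OfThm1C F N ε₀ ε₂₉ B₃ a₀ a₁).τ9.M = 1 := rfl

/-- `θ₁₅ᶜ.A₁ = 1` (`rfl`). [cite: Balaban1987RG1, (1.16) p.262 (bookkeeping)] -/
theorem theta13OfThm1C_A₁ : (theta13OfThm1C F N ε₀ ε₂₉ B₃ a₀ a₁).A₁ = 1 := rfl

/-- `θ₁₅ᶜ.Rz = RzOfRecord F N` (`rfl`). [cite: Balaban1988Convergent, (2.21) p.258 (bookkeeping)] -/
theorem theta13OfThm1C_Rz : (theta13OfThm1C F N ε₀ ε₂₉ B₃ a₀ a₁).Rz = RzOfRecord F N := rfl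

/-- `θ₁₅ᶜ.ℓ₆ + 1 = F.L`. [cite: Balaban1987RG1, (0.1) p.251 (bookkeeping)] -/
theorem theta13OfThm1C_ℓ₆_succ : (theta13OfThm1C F N ε₀ ε₂₉ B₃ a₀ a₁).ℓ₆ + 1 = F.L := stage3OfFamily_ℓ₆_succ F

/-- N10's Lemma-3 level-T binder at `θ₁₅ᶜ`: `8 ≤ θ.ℓ₆ + 1`. [cite: Balaban1987RG1, (0.1) p.251; Balaban1988RG2Cluster, (2.36) p.19] -/
theorem eight_le_L_theta13OfThm1C : 8 ≤ (theta13OfThm1C F N ε₀ ε₂₉ B₃ a₀ a₁).ℓ₆ + 1 := eight_le_L_stage3OfFamily F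

/-- Row N1 at `θ₁₅ᶜ`: the (D4) `tree` numeral. [cite: Balaban1987RG1, (0.25)–(0.26) p.257] -/
theorem kp_tree_theta13OfThm1C : 128 * Real.log 162 ≤ (theta13OfThm1C F N ε₀ ε₂₉ B₃ a₀ a₁).s2.lf.κ := kp_tree_lfConstsOfFamily

/-- Row N1 at `θ₁₅ᶜ`: the (D4) `large` numeral at the family's block size. [cite: Balaban1987RG1, (0.25)–(0.26) p.257; Balaban1988RG2Cluster, p.21 (after (2.39))] -/
theorem kp_large_theta13OfThm1C :
    10 * (64 * Real.log 162 + 1) ≤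
      (((((theta13OfThm1C F N ε₀ ε₂₉ B₃ a₀ a₁).ℓ₆ + 1 : ℕ) : ℝ)) / 2 - 1) * (theta13OfThm1C F N ε₀ ε₂₉ B₃ a₀ a₁).s2.lf.κ := by
  rw [theta13OfThm1C_ℓ₆_succ, theta13OfThm1C_s2, sect2NumericsOfThm1C_lf]
  have h3 : 3 ≤ F.L := by have := F.hL11; omega
  exact kp_large_lfConstsOfFamily_of_three_le h3

/-- Row N1 at `θ₁₅ᶜ`: N10's rate threshold. [cite: Balaban1987RG1, (1.18) p.263 (bookkeeping numeral)] -/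
theorem kp_n10_theta13OfThm1C : (2 * 10 ^ 4 : ℝ) ≤ (theta13OfThm1C F N ε₀ ε₂₉ B₃ a₀ a₁).s2.lf.κ := kp_n10_lfConstsOfFamily

/-- `θ₁₅ᶜ` carries K0b's residuals of record (`⟨rfl, rfl, rfl⟩`). [cite: Balaban1988Convergent, (3.16) p.268, (2.21) p.258, (3.20) p.269 (bookkeeping)] -/
theorem hasResidualsOfRecord_theta13OfThm1C : (theta13OfThm1C F N ε₀ ε₂₉ B₃ a₀ a₁).HasResidualsOfRecord F N :=
  hasResidualsOfRecord_theta13LiveOfNumerics F N (stage12NumericsOfThm1C F.L ε₀ B₃ a₀ a₁) ε₂₉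

/-- **… hence `ZtUnity` at `θ₁₅ᶜ`** (row Z). [cite: Balaban1988Convergent, (3.16)–(3.20) pp.268–269] -/
theorem ztUnity_theta13OfThm1C : (theta13OfThm1C F N ε₀ ε₂₉ B₃ a₀ a₁).ZtUnity F N :=
  ztUnity_theta13LiveOfNumerics F N (stage12NumericsOfThm1C F.L ε₀ B₃ a₀ a₁) ε₂₉

variable {ε₀ ε₂₉ B₃ a₀ a₁} in
/-- **`θ₁₅ᶜ` IS STAGE-13 ADMISSIBLE under the signs `0 < ε₀`, `0 < ε₂₉`, `0 ≤ B₃`, `0 < a₀`, `0 < a₁`** (row G). [cite: Balaban1987RG1, (0.21) p.256, (1.2) p.260, (2.9) p.266; Balaban1988Convergent, (2.10) p.256; Balaban1985Variational, Thm 1 p.279 (bookkeeping witness)] -/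
theorem admissible_theta13OfThm1C (hε : 0 < ε₀) (hε' : 0 < ε₂₉) (hB : 0 ≤ B₃) (ha₀ : 0 < a₀) (ha₁ : 0 < a₁) :
    (theta13OfThm1C F N ε₀ ε₂₉ B₃ a₀ a₁).Admissible F N :=
  admissible_theta13LiveOfNumerics F N _ _ _ (stage12NumericsOfThm1C_pos hε hB ha₀ ha₁) hε'

/-- **★ Row P12 at `θ₁₅ᶜ` from `Provisos₁₃` there alone.** [cite: Balaban1988Convergent, (3.22) p.269, (3.24) p.270; Balaban1989LargeFieldI, (0.3)–(0.4) p.176] -/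
theorem slotsNondegenerate₁₃_theta13OfThm1C (h : (theta13OfThm1C F N ε₀ ε₂₉ B₃ a₀ a₁).Provisos₁₃ F N) :
    (theta13OfThm1C F N ε₀ ε₂₉ B₃ a₀ a₁).SlotsNondegenerate₁₃ F N :=
  slotsNondegenerate₁₃_theta13LiveOfNumerics F N (stage12NumericsOfThm1C F.L ε₀ B₃ a₀ a₁) ε₂₉ _ _ _ h

end Witness

end Literature.MathematicalPhysics.QuantumFieldTheory.Balaban1983to89.Node00

end
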